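import Summits.Ventures.Crystal3D.Theorems.StickyWulffConstantNoReconstructionGainCubeRim
import Summits.Ventures.Crystal3D.Theorems.StickyWulffConstantNoReconstructionGainLowCoordAdhesion
import HarnessLib

/-!
# The adhesion atom at the cube facet `(100)` from a local steep-balance rule

HONEST FRAMING. Part of the venture `Summits/Ventures/Crystal3D` (cell `crystal3d-full`), helper
`--supports` the crux `NoReconstructionGain` (stmt-Ventures-19144, route
`route-Ventures-StickyWulffConstant`).  The `(100)` companion of `…LocalRuleAdhesion.lean`: with
`ν = ν₁₀₀ = (√2/2, √6/6, −√3/3)`, `η = ⟪·, ν⟫`, `c = √2/2` (the `(100)` spacing and hollow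
height), the registered atom `stub_adhesion` at `ν₁₀₀` — cross contacts `≤ D(X \ P) + C ρ` —
holds for every finite unit packing `X ⊇ P` (`P` the `(100)` slab sample, `R = 4`) whose
non-sample balls obey the LOCAL STEEP BALANCE `2·#{x ∼ q : Δη ≤ −c} + #{x ∼ q : |Δη| < c} ≤ 12`
and its mirror (`adhesion100_of_localSteepBalance`, `C = 432π`).  Corollary
`cubeLowCoordAdhesion100_eight`: the atom at `(100)` for every overlayer of coordination `≤ 8`
(`45°` cap `≤ 4`), arbitrary disorder and bond angles.

Proof: slab potential `Φ = max (η + 6c, −11c − η, 0)`, pair weights `2/1/0`, rim sites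
(`cubeRim_of_lowPotential_partner`, `card_cubeRim_le`), kissing number twelve — verbatim the
`(111)` bookkeeping.

WHAT THIS IS NOT: the atom for overlayers violating the local rule; other normals; rung F-C1 not
moved.
-/

noncomputable section

namespace Summit.Ventures.Crystal3D.Theorems

open Summit.Ventures.Crystal3D Finset Real
open Literature.MathematicalPhysics.StatisticalMechanics (barlowPos barlowStacking fccStacking
  constHagg orderedContacts contactDeficiency)
open scoped InnerProductSpace

/-- **The adhesion atom at `ν = ν₁₀₀` from local steep balance.**  With `R = 4`, `C = 432π`,
`c = √2/2`, `η = ⟪·, ν₁₀₀⟫`: for `ρ ≥ R`, every finite unit packing `X ⊇ P`, `P` the fcc `(100)`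
slab sample, such that every `q ∈ X \ P` satisfies
`2·#{x ∼ q : η x − η q ≤ −c} + #{x ∼ q : |η x − η q| < c} ≤ 12` and the mirrored inequality:
`#{(p, q) ∈ P × (X \ P) : dist p q = 1} ≤ D(X \ P) + C ρ`. -/
theorem adhesion100_of_localSteepBalance :
    ∃ R C : ℝ, 1 ≤ R ∧ ∀ ρ : ℝ, R ≤ ρ → ∀ X P : Finset (EuclideanSpace ℝ (Fin 3)),
      (∀ p ∈ X, ∀ q ∈ X, p ≠ q → 1 ≤ dist p q) → P ⊆ X →
      (∀ p, p ∈ P ↔ (p ∈ fccStacking 1 (Real.sqrt (2 / 3)) ∧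
        -(2 * R) ≤ ⟪p, (!₂[Real.sqrt 2 / 2, Real.sqrt 6 / 6, -(Real.sqrt 3 / 3)] : EuclideanSpace ℝ (Fin 3))⟫_ℝ ∧
        ⟪p, (!₂[Real.sqrt 2 / 2, Real.sqrt 6 / 6, -(Real.sqrt 3 / 3)] : EuclideanSpace ℝ (Fin 3))⟫_ℝ ≤ -R ∧
        ‖p‖ ^ 2 - ⟪p, (!₂[Real.sqrt 2 / 2, Real.sqrt 6 / 6, -(Real.sqrt 3 / 3)] : EuclideanSpace ℝ (Fin 3))⟫_ℝ ^ 2 ≤ ρ ^ 2)) →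
      (∀ q ∈ X \ P,
        2 * (X.filter fun x => dist q x = 1 ∧ ⟪x, (!₂[Real.sqrt 2 / 2, Real.sqrt 6 / 6, -(Real.sqrt 3 / 3)] : EuclideanSpace ℝ (Fin 3))⟫_ℝ - ⟪q, (!₂[Real.sqrt 2 / 2, Real.sqrt 6 / 6, -(Real.sqrt 3 / 3)] : EuclideanSpace ℝ (Fin 3))⟫_ℝ ≤ -(Real.sqrt 2 / 2)).card +
          (X.filter fun x => dist q x = 1 ∧ -(Real.sqrt 2 / 2) < ⟪x, (!₂[Real.sqrt 2 / 2, Real.sqrt 6 / 6, -(Real.sqrt 3 / 3)] : EuclideanSpace ℝ (Fin 3))⟫_ℝ - ⟪q, (!₂[Real.sqrt 2 / 2, Real.sqrt 6 / 6, -(Real.sqrt 3 / 3)] : EuclideanSpace ℝ (Fin 3))⟫_ℝ ∧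
            ⟪x, (!₂[Real.sqrt 2 / 2, Real.sqrt 6 / 6, -(Real.sqrt 3 / 3)] : EuclideanSpace ℝ (Fin 3))⟫_ℝ - ⟪q, (!₂[Real.sqrt 2 / 2, Real.sqrt 6 / 6, -(Real.sqrt 3 / 3)] : EuclideanSpace ℝ (Fin 3))⟫_ℝ < Real.sqrt 2 / 2).card ≤ 12 ∧
        2 * (X.filter fun x => dist q x = 1 ∧ Real.sqrt 2 / 2 ≤ ⟪x, (!₂[Real.sqrt 2 / 2, Real.sqrt 6 / 6, -(Real.sqrt 3 / 3)] : EuclideanSpace ℝ (Fin 3))⟫_ℝ - ⟪q, (!₂[Real.sqrt 2 / 2, Real.sqrt 6 / 6, -(Real.sqrt 3 / 3)] : EuclideanSpace ℝ (Fin 3))⟫_ℝ).card +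
          (X.filter fun x => dist q x = 1 ∧ -(Real.sqrt 2 / 2) < ⟪x, (!₂[Real.sqrt 2 / 2, Real.sqrt 6 / 6, -(Real.sqrt 3 / 3)] : EuclideanSpace ℝ (Fin 3))⟫_ℝ - ⟪q, (!₂[Real.sqrt 2 / 2, Real.sqrt 6 / 6, -(Real.sqrt 3 / 3)] : EuclideanSpace ℝ (Fin 3))⟫_ℝ ∧
            ⟪x, (!₂[Real.sqrt 2 / 2, Real.sqrt 6 / 6, -(Real.sqrt 3 / 3)] : EuclideanSpace ℝ (Fin 3))⟫_ℝ - ⟪q, (!₂[Real.sqrt 2 / 2, Real.sqrt 6 / 6, -(Real.sqrt 3 / 3)] : EuclideanSpace ℝ (Fin 3))⟫_ℝ < Real.sqrt 2 / 2).card ≤ 12) →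
      ((((P ×ˢ (X \ P)).filter fun pq => dist pq.1 pq.2 = 1).card : ℕ) : ℝ) ≤
        contactDeficiency (X \ P) + C * ρ := by
  classical
  refine ⟨4, 432 * Real.pi, by norm_num, ?_⟩
  intro ρ hρ X P hX hPX hP hloc
  set ν : EuclideanSpace ℝ (Fin 3) := !₂[Real.sqrt 2 / 2, Real.sqrt 6 / 6, -(Real.sqrt 3 / 3)]
    with hν
  obtain ⟨hc2, hc7, hc8⟩ := sqrt_two_half_bounds
  set h : ℝ := Real.sqrt 2 / 2 with hhdef
  have hhpos : 0 < h := by linarith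
  have hP' : ∀ p, p ∈ P ↔ (p ∈ fccStacking 1 (Real.sqrt (2 / 3)) ∧ -8 ≤ ⟪p, ν⟫_ℝ ∧ ⟪p, ν⟫_ℝ ≤ -4 ∧
      ‖p‖ ^ 2 - ⟪p, ν⟫_ℝ ^ 2 ≤ ρ ^ 2) := by
    intro p
    rw [hP p]
    constructor
    · rintro ⟨a, b, c, d⟩; exact ⟨a, by linarith, by linarith, d⟩
    · rintro ⟨a, b, c, d⟩; exact ⟨a, by linarith, by linarith, d⟩
  -- heights of sample sites: `-11c ≤ η ≤ -6c`
  have hslab : ∀ p ∈ P, -(11 * h) ≤ ⟪p, ν⟫_ℝ ∧ ⟪p, ν⟫_ℝ ≤ -(6 * h) := by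
    intro p hp
    obtain ⟨hΛ, h1, h2, -⟩ := (hP' p).1 hp
    obtain ⟨k, i, j, rfl⟩ := hΛ
    rw [hν, inner_barlowPos_cubeNormal] at h1 h2 ⊢
    have hk1 : -11 ≤ i + j := by
      by_contra hk
      have : ((i : ℝ) + j) ≤ -12 := by exact_mod_cast (show i + j ≤ -12 by omega)
      nlinarith
    have hk2 : i + j ≤ -6 := by
      by_contra hk
      have : (-5 : ℝ) ≤ (i : ℝ) + j := by exact_mod_cast (show -5 ≤ i + j by omega)
      nlinarith
    have hk1' : (-11 : ℝ) ≤ (i : ℝ) + j := by exact_mod_cast hk1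
    have hk2' : ((i : ℝ) + j) ≤ -6 := by exact_mod_cast hk2
    constructor <;> nlinarith
  -- the slab potential and the weights
  set Φ : EuclideanSpace ℝ (Fin 3) → ℝ := fun y => max (⟪y, ν⟫_ℝ + 6 * h) (max (-(11 * h) - ⟪y, ν⟫_ℝ) 0)
    with hΦdef
  have hΦ : ∀ y, Φ y = max (⟪y, ν⟫_ℝ + 6 * (Real.sqrt 2 / 2))
      (max (-(11 * (Real.sqrt 2 / 2)) - ⟪y, ν⟫_ℝ) 0) := fun y => rfl
  have hΦ0 : ∀ y, 0 ≤ Φ y := fun y => le_trans (le_max_right _ _) (le_max_right _ _)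
  have hΦP : ∀ p ∈ P, Φ p = 0 := by
    intro p hp
    obtain ⟨hz1, hz2⟩ := hslab p hp
    show max _ _ = 0
    rw [max_eq_right (le_trans (by linarith) (le_max_right _ _)), max_eq_right (by linarith)]
  set w : EuclideanSpace ℝ (Fin 3) → EuclideanSpace ℝ (Fin 3) → ℝ := fun q x =>
    if Φ x - Φ q ≤ -h then 2 else if Φ x - Φ q < h then 1 else 0 with hwdef
  have hw_symm : ∀ q x, w q x + w x q = 2 := by
    intro q x
    simp only [hwdef]
    have e : Φ q - Φ x = -(Φ x - Φ q) := by ring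
    rw [e]
    rcases le_or_gt (Φ x - Φ q) (-h) with h1 | h1
    · rw [if_pos h1, if_neg (by linarith), if_neg (by linarith)]; norm_num
    · rw [if_neg (not_le.2 h1)]
      rcases lt_or_ge (Φ x - Φ q) h with h2 | h2
      · rw [if_pos h2, if_neg (by linarith), if_pos (by linarith)]; norm_num
      · rw [if_neg (not_lt.2 h2), if_pos (by linarith)]; norm_num
  set Q := X \ P with hQ
  have hQX : ∀ q ∈ Q, q ∈ X ∧ q ∉ P := fun q hq => mem_sdiff.1 hq
  -- (1) per-ball bound from the local rule
  have hΦlo : ∀ y, ⟪y, ν⟫_ℝ + 6 * h ≤ Φ y := fun y => le_max_left _ _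
  have hΦlo' : ∀ y, -(11 * h) - ⟪y, ν⟫_ℝ ≤ Φ y := fun y => le_trans (le_max_left _ _) (le_max_right _ _)
  have hball : ∀ q ∈ Q, ∑ x ∈ X, (if dist q x = 1 then w q x else 0) ≤ 12 := by
    intro q hq
    obtain ⟨hup_rule, hdown_rule⟩ := hloc q hq
    set N := X.filter fun x => dist q x = 1 with hN
    rw [← sum_filter]
    -- a comparison weight `w'` computed from a lower bound `d x ≤ Φ x - Φ q`
    have hmono : ∀ (d : ℝ) (x : EuclideanSpace ℝ (Fin 3)), d ≤ Φ x - Φ q →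
        w q x ≤ (if d ≤ -h then 2 else if d < h then 1 else 0) := by
      intro d x hd
      simp only [hwdef]
      by_cases h1 : Φ x - Φ q ≤ -h
      · rw [if_pos h1, if_pos (by linarith)]
      · rw [if_neg h1]
        by_cases h2 : Φ x - Φ q < h
        · rw [if_pos h2]
          by_cases h3 : d ≤ -h
          · rw [if_pos h3]; norm_num
          · rw [if_neg h3, if_pos (by linarith)]
        · rw [if_neg h2]; split_ifs <;> norm_num
    -- the sum of the comparison weights is `2·#steep + #middle`
    have hsumw : ∀ d : EuclideanSpace ℝ (Fin 3) → ℝ,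
        ∑ x ∈ N, (if d x ≤ -h then (2 : ℝ) else if d x < h then 1 else 0) =
          2 * ((X.filter fun x => dist q x = 1 ∧ d x ≤ -h).card : ℝ) +
            ((X.filter fun x => dist q x = 1 ∧ -h < d x ∧ d x < h).card : ℝ) := by
      intro d
      have e : ∀ x, (if d x ≤ -h then (2 : ℝ) else if d x < h then 1 else 0) =
          2 * (if d x ≤ -h then (1 : ℝ) else 0) + (if -h < d x ∧ d x < h then 1 else 0) := by
        intro x
        by_cases h1 : d x ≤ -h
        · rw [if_pos h1, if_pos h1, if_neg (fun hh => by linarith [hh.1])]; norm_num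
        · rw [if_neg h1, if_neg h1]
          by_cases h2 : d x < h
          · rw [if_pos h2, if_pos ⟨not_le.1 h1, h2⟩]; norm_num
          · rw [if_neg h2, if_neg (fun hh => h2 hh.2)]; norm_num
      rw [sum_congr rfl (fun x _ => e x), sum_add_distrib, ← mul_sum, sum_boole, sum_boole, hN,
        filter_filter, filter_filter]
    by_cases hup : -(6 * h) < ⟪q, ν⟫_ℝ
    · -- above the slab: `Φ x - Φ q ≥ η x - η q`
      have hΦq : Φ q = ⟪q, ν⟫_ℝ + 6 * h := by
        show max _ _ = _
        rw [max_eq_left]; exact max_le (by linarith) (by linarith)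
      calc ∑ x ∈ N, w q x ≤ ∑ x ∈ N, (if ⟪x, ν⟫_ℝ - ⟪q, ν⟫_ℝ ≤ -h then (2 : ℝ)
            else if ⟪x, ν⟫_ℝ - ⟪q, ν⟫_ℝ < h then 1 else 0) :=
            sum_le_sum fun x _ => hmono _ x (by rw [hΦq]; linarith [hΦlo x])
        _ ≤ 12 := by
            rw [hsumw (fun x => ⟪x, ν⟫_ℝ - ⟪q, ν⟫_ℝ)]
            exact_mod_cast hup_rule
    by_cases hdown : ⟪q, ν⟫_ℝ < -(11 * h)
    · -- below the slab: `Φ x - Φ q ≥ -(η x - η q)`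
      have hΦq : Φ q = -(11 * h) - ⟪q, ν⟫_ℝ := by
        show max _ _ = _
        rw [max_eq_right_of_lt (by
          calc ⟪q, ν⟫_ℝ + 6 * h < -(11 * h) - ⟪q, ν⟫_ℝ := by linarith
            _ ≤ max (-(11 * h) - ⟪q, ν⟫_ℝ) 0 := le_max_left _ _), max_eq_left (by linarith)]
      calc ∑ x ∈ N, w q x
          ≤ ∑ x ∈ N, (if -(⟪x, ν⟫_ℝ - ⟪q, ν⟫_ℝ) ≤ -h then (2 : ℝ)
              else if -(⟪x, ν⟫_ℝ - ⟪q, ν⟫_ℝ) < h then 1 else 0) :=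
            sum_le_sum fun x _ => hmono _ x (by rw [hΦq]; linarith [hΦlo' x])
        _ ≤ 12 := by
            rw [hsumw (fun x => -(⟪x, ν⟫_ℝ - ⟪q, ν⟫_ℝ))]
            have e1 : (X.filter fun x => dist q x = 1 ∧ -(⟪x, ν⟫_ℝ - ⟪q, ν⟫_ℝ) ≤ -h) =
                X.filter fun x => dist q x = 1 ∧ h ≤ ⟪x, ν⟫_ℝ - ⟪q, ν⟫_ℝ :=
              filter_congr fun x _ => by constructor <;> rintro ⟨a, b⟩ <;> exact ⟨a, by linarith⟩
            have e2 : (X.filter fun x => dist q x = 1 ∧ -h < -(⟪x, ν⟫_ℝ - ⟪q, ν⟫_ℝ) ∧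
                -(⟪x, ν⟫_ℝ - ⟪q, ν⟫_ℝ) < h) =
                X.filter fun x => dist q x = 1 ∧ -h < ⟪x, ν⟫_ℝ - ⟪q, ν⟫_ℝ ∧ ⟪x, ν⟫_ℝ - ⟪q, ν⟫_ℝ < h :=
              filter_congr fun x _ => by
                constructor <;> rintro ⟨a, b, c⟩ <;> exact ⟨a, by linarith, by linarith⟩
            rw [e1, e2]
            exact_mod_cast hdown_rule
    · -- inside the slab: every weight is at most `1`, and a ball has at most twelve partners
      have hΦq : Φ q = 0 := by
        show max _ _ = _
        rw [max_eq_right (le_trans (by linarith [not_lt.1 hup]) (le_max_right _ _)),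
          max_eq_right (by linarith [not_lt.1 hdown])]
      have hw1 : ∀ x ∈ N, w q x ≤ 1 := by
        intro x _
        simp only [hwdef, hΦq, sub_zero]
        rw [if_neg (by linarith [hΦ0 x, hhpos])]
        split_ifs <;> norm_num
      calc ∑ x ∈ N, w q x ≤ ∑ _x ∈ N, (1 : ℝ) := sum_le_sum hw1
        _ = (N.card : ℝ) := by simp
        _ ≤ 12 := by exact_mod_cast card_partners_le_twelve X hX q
  have h12 : ∑ q ∈ Q, ∑ x ∈ X, (if dist q x = 1 then w q x else 0) ≤ 12 * (Q.card : ℝ) := by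
    calc ∑ q ∈ Q, ∑ x ∈ X, (if dist q x = 1 then w q x else 0) ≤ ∑ _q ∈ Q, (12 : ℝ) :=
          sum_le_sum hball
      _ = 12 * (Q.card : ℝ) := by rw [sum_const, nsmul_eq_mul, mul_comm]
  -- (2) split the inner sum over `X = Q ∪ P`
  have hXQP : X = Q ∪ P := by rw [hQ, sdiff_union_of_subset hPX]
  have hdisj : Disjoint Q P := by rw [hQ]; exact sdiff_disjoint
  have hsplit : ∑ q ∈ Q, ∑ x ∈ X, (if dist q x = 1 then w q x else 0) =
      (∑ q ∈ Q, ∑ x ∈ Q, (if dist q x = 1 then w q x else 0)) +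
        ∑ q ∈ Q, ∑ p ∈ P, (if dist q p = 1 then w q p else 0) := by
    rw [← sum_add_distrib]
    refine sum_congr rfl fun q _ => ?_
    rw [hXQP, sum_union hdisj]
  -- (2a) the `Q`-`Q` part is `orderedContacts Q`
  have hQQ : ∑ q ∈ Q, ∑ x ∈ Q, (if dist q x = 1 then w q x else 0) = (orderedContacts Q : ℝ) := by
    set S := ∑ q ∈ Q, ∑ x ∈ Q, (if dist q x = 1 then w q x else 0) with hS
    have hS' : S = ∑ q ∈ Q, ∑ x ∈ Q, (if dist q x = 1 then w x q else 0) := by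
      rw [hS, sum_comm]
      refine sum_congr rfl fun x _ => sum_congr rfl fun q _ => ?_
      rw [dist_comm]
    have hsum2 : (∑ q ∈ Q, ∑ x ∈ Q, (if dist q x = 1 then w q x else 0)) +
        (∑ q ∈ Q, ∑ x ∈ Q, (if dist q x = 1 then w x q else 0)) =
        ∑ q ∈ Q, ∑ x ∈ Q, (if dist q x = 1 then (2 : ℝ) else 0) := by
      rw [← sum_add_distrib]
      refine sum_congr rfl fun q _ => ?_
      rw [← sum_add_distrib]
      refine sum_congr rfl fun x _ => ?_
      by_cases hqx : dist q x = 1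
      · rw [if_pos hqx, if_pos hqx, if_pos hqx]; exact hw_symm q x
      · rw [if_neg hqx, if_neg hqx, if_neg hqx]; norm_num
    have h2S : 2 * S = ∑ q ∈ Q, ∑ x ∈ Q, (if dist q x = 1 then (2 : ℝ) else 0) := by
      rw [two_mul, ← hsum2, ← hS', hS]
    rw [orderedContacts_eq_sum_sum]
    have : ∑ q ∈ Q, ∑ x ∈ Q, (if dist q x = 1 then (2 : ℝ) else 0) =
        2 * ∑ q ∈ Q, ∑ x ∈ Q, (if dist q x = 1 then (1 : ℝ) else 0) := by
      rw [mul_sum]; refine sum_congr rfl fun q _ => ?_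
      rw [mul_sum]; refine sum_congr rfl fun x _ => ?_
      split_ifs <;> norm_num
    linarith
  -- (2b) the cross part: weight `2` except at rim sites
  set rim := P.filter fun p => (ρ - 2) ^ 2 < ‖p‖ ^ 2 - ⟪p, ν⟫_ℝ ^ 2 with hrim
  have hwP : ∀ q ∈ Q, ∀ p ∈ P, dist q p = 1 →
      (2 : ℝ) - (if p ∈ rim then 1 else 0) ≤ w q p := by
    intro q hq p hp hqp
    have hΦp := hΦP p hp
    show (2 : ℝ) - (if p ∈ rim then 1 else 0) ≤
      (if Φ p - Φ q ≤ -h then 2 else if Φ p - Φ q < h then 1 else 0)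
    rw [hΦp, zero_sub]
    by_cases hge : h ≤ Φ q
    · rw [if_pos (show -Φ q ≤ -h by linarith)]
      by_cases hpr : p ∈ rim
      · rw [if_pos hpr]; norm_num
      · rw [if_neg hpr]; norm_num
    · have hlt := not_le.1 hge
      rw [if_neg (show ¬ (-Φ q ≤ -h) from not_le.2 (by linarith)),
        if_pos (show -Φ q < h by linarith [hΦ0 q])]
      have hprim : p ∈ rim := by
        rw [hrim, mem_filter]
        refine ⟨hp, ?_⟩
        exact cubeRim_of_lowPotential_partner ρ hρ X P hX hPX hP' Φ hΦ p q (hQX q hq).1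
          (hQX q hq).2 (by rw [dist_comm]; exact hqp) hlt
      rw [if_pos hprim]; norm_num
  have hcross : ((((P ×ˢ Q).filter fun pq => dist pq.1 pq.2 = 1).card : ℕ) : ℝ) =
      ∑ q ∈ Q, ∑ p ∈ P, (if dist q p = 1 then (1 : ℝ) else 0) := by
    rw [card_crossContacts_eq_sum_sum, sum_comm]
    refine sum_congr rfl fun q _ => sum_congr rfl fun p _ => ?_
    rw [dist_comm]
  have hrim12 : ∑ q ∈ Q, ∑ p ∈ P, (if dist q p = 1 then (if p ∈ rim then (1 : ℝ) else 0) else 0)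
      ≤ 12 * (rim.card : ℝ) := by
    rw [sum_comm]
    have hz : ∀ p ∈ P, p ∉ rim →
        ∑ q ∈ Q, (if dist q p = 1 then (if p ∈ rim then (1 : ℝ) else 0) else 0) = 0 := by
      intro p _ hpr
      exact sum_eq_zero fun q _ => by simp [hpr]
    rw [← sum_filter_add_sum_filter_not P (fun p => p ∈ rim), sum_congr rfl (fun p hp =>
      hz p (mem_filter.1 hp).1 (mem_filter.1 hp).2), sum_const_zero, add_zero]
    have hPr : P.filter (fun p => p ∈ rim) = rim := by
      ext p; rw [mem_filter, hrim, mem_filter]; tauto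
    rw [hPr]
    have hle : ∀ p ∈ rim, ∑ q ∈ Q, (if dist q p = 1 then (if p ∈ rim then (1 : ℝ) else 0) else 0)
        ≤ 12 := by
      intro p hpr
      have hpX : p ∈ X := hPX (mem_filter.1 hpr).1
      calc ∑ q ∈ Q, (if dist q p = 1 then (if p ∈ rim then (1 : ℝ) else 0) else 0)
          = ∑ q ∈ Q, (if dist p q = 1 then (1 : ℝ) else 0) := by
            refine sum_congr rfl fun q _ => ?_
            rw [if_pos hpr, dist_comm]
        _ = ((Q.filter fun q => dist p q = 1).card : ℝ) := by rw [sum_boole]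
        _ ≤ ((X.filter fun q => dist p q = 1).card : ℝ) := by
            exact_mod_cast card_le_card (filter_subset_filter _ (by rw [hQ]; exact sdiff_subset))
        _ ≤ 12 := by exact_mod_cast card_partners_le_twelve X hX p
    calc ∑ p ∈ rim, ∑ q ∈ Q, (if dist q p = 1 then (if p ∈ rim then (1 : ℝ) else 0) else 0)
        ≤ ∑ _p ∈ rim, (12 : ℝ) := sum_le_sum hle
      _ = 12 * (rim.card : ℝ) := by rw [sum_const, nsmul_eq_mul, mul_comm]
  have hQP : 2 * ((((P ×ˢ Q).filter fun pq => dist pq.1 pq.2 = 1).card : ℕ) : ℝ) -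
      12 * (rim.card : ℝ) ≤ ∑ q ∈ Q, ∑ p ∈ P, (if dist q p = 1 then w q p else 0) := by
    rw [hcross, mul_sum]
    have hpt : ∀ q ∈ Q, 2 * ∑ p ∈ P, (if dist q p = 1 then (1 : ℝ) else 0) -
        ∑ p ∈ P, (if dist q p = 1 then (if p ∈ rim then (1 : ℝ) else 0) else 0) ≤
        ∑ p ∈ P, (if dist q p = 1 then w q p else 0) := by
      intro q hq
      rw [mul_sum, ← sum_sub_distrib]
      refine sum_le_sum fun p hp => ?_
      by_cases hqp : dist q p = 1
      · rw [if_pos hqp, if_pos hqp, if_pos hqp]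
        have := hwP q hq p hp hqp; linarith
      · rw [if_neg hqp, if_neg hqp, if_neg hqp]; norm_num
    have := sum_le_sum hpt
    rw [sum_sub_distrib] at this
    linarith [hrim12]
  -- (3) assemble
  have hrimle : (rim.card : ℝ) ≤ 72 * Real.pi * ρ := card_cubeRim_le ρ hρ P hP'
  have hmain : (orderedContacts Q : ℝ) +
      (2 * ((((P ×ˢ Q).filter fun pq => dist pq.1 pq.2 = 1).card : ℕ) : ℝ) -
        12 * (rim.card : ℝ)) ≤ 12 * (Q.card : ℝ) := by
    rw [← hQQ]; linarith [hsplit, h12, hQP]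
  show ((((P ×ˢ Q).filter fun pq => dist pq.1 pq.2 = 1).card : ℕ) : ℝ) ≤
    contactDeficiency Q + 432 * Real.pi * ρ
  unfold contactDeficiency
  nlinarith [hmain, hrimle, Real.pi_pos]


/-- **`LowCoordAdhesion100 8`** — the adhesion atom at the cube facet for all overlayers of
coordination at most eight (arbitrary disorder, oblique bonds allowed).  With `R = 4`,
`C = 432π`. -/
theorem cubeLowCoordAdhesion100_eight :
    ∃ R C : ℝ, 1 ≤ R ∧ ∀ ρ : ℝ, R ≤ ρ → ∀ X P : Finset (EuclideanSpace ℝ (Fin 3)),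
      (∀ p ∈ X, ∀ q ∈ X, p ≠ q → 1 ≤ dist p q) → P ⊆ X →
      (∀ p, p ∈ P ↔ (p ∈ fccStacking 1 (Real.sqrt (2 / 3)) ∧
        -(2 * R) ≤ ⟪p, (!₂[Real.sqrt 2 / 2, Real.sqrt 6 / 6, -(Real.sqrt 3 / 3)] : EuclideanSpace ℝ (Fin 3))⟫_ℝ ∧
        ⟪p, (!₂[Real.sqrt 2 / 2, Real.sqrt 6 / 6, -(Real.sqrt 3 / 3)] : EuclideanSpace ℝ (Fin 3))⟫_ℝ ≤ -R ∧
        ‖p‖ ^ 2 - ⟪p, (!₂[Real.sqrt 2 / 2, Real.sqrt 6 / 6, -(Real.sqrt 3 / 3)] : EuclideanSpace ℝ (Fin 3))⟫_ℝ ^ 2 ≤ ρ ^ 2)) →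
      (∀ q ∈ X \ P, (X.filter fun x => dist q x = 1).card ≤ 8) →
      ((((P ×ˢ (X \ P)).filter fun pq => dist pq.1 pq.2 = 1).card : ℕ) : ℝ) ≤
        contactDeficiency (X \ P) + C * ρ := by
  classical
  obtain ⟨R, C, hR, hmain⟩ := adhesion100_of_localSteepBalance
  refine ⟨R, C, hR, fun ρ hρ X P hX hPX hP hdeg => hmain ρ hρ X P hX hPX hP fun q hq => ?_⟩
  set ν : EuclideanSpace ℝ (Fin 3) := !₂[Real.sqrt 2 / 2, Real.sqrt 6 / 6, -(Real.sqrt 3 / 3)] with hν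
  have hνn : ‖ν‖ = 1 := norm_cubeNormal
  set N := X.filter fun x => dist q x = 1 with hN
  have hN8 : N.card ≤ 8 := hdeg q hq
  -- partners as unit vectors
  have himg : ∀ (S : Finset (EuclideanSpace ℝ (Fin 3))), S ⊆ N →
      (S.image fun x => x - q).card = S.card ∧
      (∀ u ∈ S.image (fun x => x - q), ‖u‖ = 1) ∧
      (∀ u ∈ S.image (fun x => x - q), ∀ w ∈ S.image (fun x => x - q), u ≠ w →
        ⟪u, w⟫_ℝ ≤ 1 / 2) := by
    intro S hS
    have hS' : ∀ x ∈ S, x ∈ X ∧ dist q x = 1 := fun x hx => by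
      have := mem_filter.1 (hS hx); exact ⟨this.1, this.2⟩
    refine ⟨card_image_of_injOn fun x _ y _ hxy => sub_left_injective hxy, ?_, ?_⟩
    · intro u hu
      obtain ⟨x, hx, rfl⟩ := mem_image.1 hu
      rw [← dist_eq_norm, dist_comm]; exact (hS' x hx).2
    · intro u hu w hw huw
      obtain ⟨x, hx, rfl⟩ := mem_image.1 hu
      obtain ⟨y, hy, rfl⟩ := mem_image.1 hw
      have hux : ‖x - q‖ = 1 := by rw [← dist_eq_norm, dist_comm]; exact (hS' x hx).2
      have huy : ‖y - q‖ = 1 := by rw [← dist_eq_norm, dist_comm]; exact (hS' y hy).2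
      refine inner_le_half_of_one_le_dist hux huy ?_
      rw [dist_eq_norm, sub_sub_sub_cancel_right, ← dist_eq_norm]
      exact hX x (hS' x hx).1 y (hS' y hy).1 fun hxy => huw (by rw [hxy])
  have hsub : ∀ (pr : EuclideanSpace ℝ (Fin 3) → Prop) [DecidablePred pr],
      (X.filter fun x => dist q x = 1 ∧ pr x) ⊆ N := by
    intro pr _ x hx
    rw [hN, mem_filter]; exact ⟨(mem_filter.1 hx).1, (mem_filter.1 hx).2.1⟩
  have hdown : (X.filter fun x => dist q x = 1 ∧ ⟪x, ν⟫_ℝ - ⟪q, ν⟫_ℝ ≤ -(Real.sqrt 2 / 2)).card ≤ 4 := by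
    obtain ⟨hc, hu, hs⟩ := himg _ (hsub fun x => ⟪x, ν⟫_ℝ - ⟪q, ν⟫_ℝ ≤ -(Real.sqrt 2 / 2))
    rw [← hc]
    refine card_cap45_le_four ν hνn hu (fun u hu' => ?_) hs
    obtain ⟨x, hx, rfl⟩ := mem_image.1 hu'
    rw [inner_sub_left]; exact (mem_filter.1 hx).2.2
  have hup : (X.filter fun x => dist q x = 1 ∧ Real.sqrt 2 / 2 ≤ ⟪x, ν⟫_ℝ - ⟪q, ν⟫_ℝ).card ≤ 4 := by
    obtain ⟨hc, hu, hs⟩ := himg _ (hsub fun x => Real.sqrt 2 / 2 ≤ ⟪x, ν⟫_ℝ - ⟪q, ν⟫_ℝ)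
    rw [← hc]
    refine card_cap45_le_four' ν hνn hu (fun u hu' => ?_) hs
    obtain ⟨x, hx, rfl⟩ := mem_image.1 hu'
    rw [inner_sub_left]; exact (mem_filter.1 hx).2.2
  -- steep + middle partners are distinct partners, hence at most eight together
  have hdisj1 : (X.filter fun x => dist q x = 1 ∧ ⟪x, ν⟫_ℝ - ⟪q, ν⟫_ℝ ≤ -(Real.sqrt 2 / 2)).card +
      (X.filter fun x => dist q x = 1 ∧ -(Real.sqrt 2 / 2) < ⟪x, ν⟫_ℝ - ⟪q, ν⟫_ℝ ∧
        ⟪x, ν⟫_ℝ - ⟪q, ν⟫_ℝ < Real.sqrt 2 / 2).card ≤ N.card := by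
    rw [← card_union_of_disjoint (disjoint_filter.2 fun x _ h1 h2 => by linarith [h1.2, h2.2.1])]
    exact card_le_card (union_subset (hsub _) (hsub _))
  have hdisj2 : (X.filter fun x => dist q x = 1 ∧ Real.sqrt 2 / 2 ≤ ⟪x, ν⟫_ℝ - ⟪q, ν⟫_ℝ).card +
      (X.filter fun x => dist q x = 1 ∧ -(Real.sqrt 2 / 2) < ⟪x, ν⟫_ℝ - ⟪q, ν⟫_ℝ ∧
        ⟪x, ν⟫_ℝ - ⟪q, ν⟫_ℝ < Real.sqrt 2 / 2).card ≤ N.card := by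
    rw [← card_union_of_disjoint (disjoint_filter.2 fun x _ h1 h2 => by linarith [h1.2, h2.2.2])]
    exact card_le_card (union_subset (hsub _) (hsub _))
  constructor <;> omega

end Summit.Ventures.Crystal3D.Theorems

end
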